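import Summits.QuantumFields.BalabanUV.Beta.SymmetrisedAxialPotential

/-!
# `BalabanUV.Beta.SymmetrisedLoopWords` — binder row D1, RULING R-D1-g25-1 step S1b: THE `(σ,σ′)`-FAMILY OF BLOCK CONTOURS AND CLOSED LOOP
# WORDS OF [Balaban1987RG1] (0.4) AS LETTER LISTS — `Γ^σ_{c₋,x} ∪ [x,x′] ∪ (−Γ^{σ′}_{c₊,x′})` and `… ∪ (−c)` — the objects an1's list-generic
# second-order letter functionals (node 7a∕7aρ: `hessUAt`, `vhUAt`, …) must be fed for the re-based literal «JsB12Sym» (spec S2)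

HONEST FRAMING (cell contract, verbatim): «discharging `BetaPertH` makes Bałaban's UV stability UNCONDITIONAL — a real constructive-QFT
result; it is NOT the continuum limit and NOT the Clay problem.»  THIS MODULE DISCHARGES NOTHING of `BetaPertH` ∕ row D1: [folklore] letter
lists and finite sums on `ℤ^d` (Form level).  0 sorry, 0 `def … : Prop`, nothing cited as a fact; quotations are OBJECT LOCATORS.

WHAT.  [Balaban1987RG1] p.252–253: the contour family `G(y,x)` «generated by all such permutations» and (0.4)
`Ū(c) = exp[i Σ_{x∈B(c₋)} L^{−d} Σ_{Γ∈G(c₋,x)} |G(c₋,x)|⁻¹ Σ_{Γ′∈G(c₊,x′)} |G(c₊,x′)|⁻¹ (1∕i) log U(Γ ∪ [x,x′] ∪ (−Γ′) ∪ (−c))] U(c)` — «the simplest,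
immediate extension of the definition of averages in [12]» (= [Balaban1985Averaging], whose single-contour loop words are the cell's
`AveragingContoursRooted.gammaCAt ρ`∕`loopCAt ρ`).  Here: the open word `gammaCAtPerm σ σ′ ρ` and the closed loop word `loopCAtPerm σ σ′ ρ` with
INDEPENDENT axis orders `σ` (leg at `c₋`) and `σ′` (leg at `c₊`), as letter lists of a 1-form `A`, built from S1's transported comb
`axialPermList σ` (= `AveragingContours.axial` of the pulled-back form `P1 σ A` between pulled-back endpoints).  PROVED: `(1,1)` gives back the
cell's words (`gammaCAtPerm_one_one`, `loopCAtPerm_one_one`); exact forms telescope ∕ loops have zero circulation (`gammaCAtPerm_sum_grad`,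
`loopCAtPerm_sum_grad`); block translation (`gammaCAtPerm_add`); and THE DOUBLE-MEAN IDENTITY at linear order:
`Σ_{x∈B} Σ_{σ,σ′} ΣA(gammaCAtPerm σ σ′ …) = d! · symLinAvgAt ρ A L μ y` (`sum_pairs_gammaCAtPerm`) — the `(d!)²` pair words, summed, ARE `d!` times
S1's symmetrised rooted averaging (independent means over `Γ`, `Γ′` are additive at linear order).  [analysis, R-D1-g25-1 (4)(R1)]: the uniform
mean over the `(d!)²` ORDER pairs reproduces (0.4)'s weights `|G(c₋,x)|⁻¹|G(c₊,x′)|⁻¹` exactly, because two orders inducing the same order on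
the moving axes give the SAME letter list (the idle axes contribute empty segments) and a contour moving `m` axes arises from `d!∕m!` orders.
SPEC S2 (→ an1): the second-order tables of the re-based literal are node 7a's list-generic functionals evaluated on `loopCAtPerm σ σ′ ρ`
(resp. the product chart on `gammaCAtPerm`) and AVERAGED over the pair `(σ,σ′)` — not the `σ`-mean of the single-comb tables.
NOT HERE: those functionals; kernels; reflections; estimates; any identification with Bałaban's minimisers ∕ propagators ∕ β.
NOT D1, NOT BetaPertH, NOT continuum, NOT Clay.
HONEST DEPENDENCY (verbatim): «continuum YM on T⁴ ⇐ BetaPertH ∧ nine spine estimates (0/9 proved); BetaPertH ⇐ (D1) ∧ (D4) ∧ CAP+tail;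
G-an2-4 gates asym, D1 and NE2/3/4.»  ABSOLUTE RULE (cell, verbatim): «No internally-minted statement may enter as a cited fact. Every
hypothesis is either kernel-proved in this package or a verbatim quotation of a PUBLISHED theorem with page reference.»
Unit `b2b-balaban-beta-an2` gen 25 (row-D1 owner), 2026-08-21.
-/

namespace Summit.QuantumFields.BalabanUV.Beta.SymmetrisedLoopWords

noncomputable section

open Finset
open scoped BigOperators Nat
open Literature.MathematicalPhysics.QuantumFieldTheory.Balaban1983to89.Beta
open AffineAveraging (Form0 Form1 Site unitVec dz box toSite contourSum)
open AveragingContours (grad shift axial axial_sum_grad axial_add segUp segUp_sum segUp_sum_grad segUp_add rev rev_sum)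
open AveragingContoursRooted (gammaCAt loopCAt linAvgAt)
open Summit.QuantumFields.BalabanUV.Beta.KernelPermutation (psite psite_apply psite_symm_apply psite_add psite_smul)
open Summit.QuantumFields.BalabanUV.Beta.ResolventPermutation (P0 P1 P0_apply P1_apply)
open Summit.QuantumFields.BalabanUV.Beta.SymmetrisedAxialPotential

variable {d : ℕ}

/-! ## §1 The transported comb as a LETTER LIST -/

/-- [our object] The letters of `A` along the comb `Γ^σ_{y,x}` with axis order `σ` (S1's `axialPerm` is their sum). -/
def axialPermList (σ : Equiv.Perm (Fin d)) (A : Form1 d ℝ) (y x : Site d) : List ℝ :=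
  axial (P1 σ A) ((psite σ).symm y) ((psite σ).symm x)

/-- [folklore] The letter sum IS S1's transported comb integral. -/
theorem axialPermList_sum (σ : Equiv.Perm (Fin d)) (A : Form1 d ℝ) (y x : Site d) : (axialPermList σ A y x).sum = axialPerm σ A y x := rfl

/-- [folklore] The identity order gives the cell's comb letters. -/
theorem axialPermList_one (A : Form1 d ℝ) (y x : Site d) : axialPermList 1 A y x = axial A y x := rfl

/-- [folklore] Block translation of the transported letters. -/
theorem axialPermList_add (σ : Equiv.Perm (Fin d)) (A : Form1 d ℝ) (y x v : Site d) :
    axialPermList σ A (y + v) (x + v) = axialPermList σ (shift v A) y x := by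
  simp only [axialPermList, P1_shift, psite_symm_add, ← axial_add]

/-! ## §2 The open word `Γ^σ_{c₋,x} ∪ [x, x(c)] ∪ (−Γ^{σ′}_{c₊,x(c)})` and the closed loop word `… ∪ (−c)` -/

/-- [our object] **THE `(σ,σ′)` BLOCK CONTOUR** of [Balaban1987RG1] (0.4) for the coarse bond `c = ⟨r, r + L e_μ⟩`, root `r = L·y + ρ`, fine point
`x = L·y + b`: the `σ`-comb from `r` to `x`, the straight segment `[x, x + L e_μ]`, the reversed `σ′`-comb from `r + L e_μ` to `x + L e_μ`
(cf. `AveragingContoursRooted.gammaCAt ρ` = the case `σ = σ′ = 1`). -/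
def gammaCAtPerm (σ σ' : Equiv.Perm (Fin d)) (ρ : Site d) (A : Form1 d ℝ) (L : ℕ) (μ : Fin d) (y : Site d) (b : Fin d → ℕ) : List ℝ :=
  axialPermList σ A ((L : ℤ) • y + ρ) ((L : ℤ) • y + toSite b)
    ++ segUp A ((L : ℤ) • y + toSite b) μ L
    ++ rev (axialPermList σ' A ((L : ℤ) • y + ρ + (L : ℤ) • unitVec μ) ((L : ℤ) • y + toSite b + (L : ℤ) • unitVec μ))

/-- [our object] **THE `(σ,σ′)` CLOSED LOOP WORD** `Γ^σ ∪ [x,x′] ∪ (−Γ′^{σ′}) ∪ (−c)` of (0.4): back to the root along the reversed straight coarse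
bond (cf. `AveragingContoursRooted.loopCAt ρ`). -/
def loopCAtPerm (σ σ' : Equiv.Perm (Fin d)) (ρ : Site d) (A : Form1 d ℝ) (L : ℕ) (μ : Fin d) (y : Site d) (b : Fin d → ℕ) : List ℝ :=
  gammaCAtPerm σ σ' ρ A L μ y b ++ rev (segUp A ((L : ℤ) • y + ρ) μ L)

/-- [folklore] BRIDGE: the pair `(1,1)` gives back the cell's single-comb block contour. -/
theorem gammaCAtPerm_one_one (ρ : Site d) (A : Form1 d ℝ) (L : ℕ) (μ : Fin d) (y : Site d) (b : Fin d → ℕ) :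
    gammaCAtPerm 1 1 ρ A L μ y b = gammaCAt ρ A L μ y b := rfl

/-- [folklore] BRIDGE: the pair `(1,1)` gives back the cell's single-comb loop word. -/
theorem loopCAtPerm_one_one (ρ : Site d) (A : Form1 d ℝ) (L : ℕ) (μ : Fin d) (y : Site d) (b : Fin d → ℕ) :
    loopCAtPerm 1 1 ρ A L μ y b = loopCAt ρ A L μ y b := rfl

/-- [folklore] **LINEARISED GAUGE COVARIANCE**: on an exact form the `(σ,σ′)` contour reads `f` at the two ROOTS only — `f(r + L e_μ) − f(r)` —
for every pair of orders and every `x ∈ B(y)`. -/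
theorem gammaCAtPerm_sum_grad (σ σ' : Equiv.Perm (Fin d)) (ρ : Site d) (f : Form0 d ℝ) (L : ℕ) (μ : Fin d) (y : Site d) (b : Fin d → ℕ) :
    (gammaCAtPerm σ σ' ρ (grad f) L μ y b).sum = f ((L : ℤ) • y + ρ + (L : ℤ) • unitVec μ) - f ((L : ℤ) • y + ρ) := by
  simp only [gammaCAtPerm, List.sum_append, rev_sum, axialPermList_sum, axialPerm_grad, segUp_sum_grad]
  abel

/-- [folklore] The `(σ,σ′)` closed loop word has zero circulation on exact forms. -/
theorem loopCAtPerm_sum_grad (σ σ' : Equiv.Perm (Fin d)) (ρ : Site d) (f : Form0 d ℝ) (L : ℕ) (μ : Fin d) (y : Site d) (b : Fin d → ℕ) :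
    (loopCAtPerm σ σ' ρ (grad f) L μ y b).sum = 0 := by
  simp only [loopCAtPerm, List.sum_append, rev_sum, gammaCAtPerm_sum_grad, segUp_sum_grad]
  abel

/-- [folklore] Block translation `y ↦ y + v` of the pair contour = translation of the form by `L·v` (root offset fixed). -/
theorem gammaCAtPerm_add (σ σ' : Equiv.Perm (Fin d)) (ρ : Site d) (A : Form1 d ℝ) (L : ℕ) (μ : Fin d) (y v : Site d) (b : Fin d → ℕ) :
    gammaCAtPerm σ σ' ρ A L μ (y + v) b = gammaCAtPerm σ σ' ρ (shift ((L : ℤ) • v) A) L μ y b := by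
  have h1 : (L : ℤ) • (y + v) + ρ = (L : ℤ) • y + ρ + (L : ℤ) • v := by rw [smul_add]; abel
  have h2 : (L : ℤ) • (y + v) + toSite b = (L : ℤ) • y + toSite b + (L : ℤ) • v := by rw [smul_add]; abel
  have h3 : (L : ℤ) • y + ρ + (L : ℤ) • v + (L : ℤ) • unitVec μ = (L : ℤ) • y + ρ + (L : ℤ) • unitVec μ + (L : ℤ) • v := by abel
  have h4 : (L : ℤ) • y + toSite b + (L : ℤ) • v + (L : ℤ) • unitVec μ = (L : ℤ) • y + toSite b + (L : ℤ) • unitVec μ + (L : ℤ) • v := by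
    abel
  have e1 := axialPermList_add σ A ((L : ℤ) • y + ρ) ((L : ℤ) • y + toSite b) ((L : ℤ) • v)
  have e2 : segUp A ((L : ℤ) • y + toSite b + (L : ℤ) • v) μ L = segUp (shift ((L : ℤ) • v) A) ((L : ℤ) • y + toSite b) μ L :=
    segUp_add A _ _ μ L
  have e3 := axialPermList_add σ' A ((L : ℤ) • y + ρ + (L : ℤ) • unitVec μ) ((L : ℤ) • y + toSite b + (L : ℤ) • unitVec μ) ((L : ℤ) • v)
  unfold gammaCAtPerm
  rw [h1, h2, h3, h4, e1, e2, e3]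

/-- [folklore] Block translation of the pair loop word. -/
theorem loopCAtPerm_add (σ σ' : Equiv.Perm (Fin d)) (ρ : Site d) (A : Form1 d ℝ) (L : ℕ) (μ : Fin d) (y v : Site d) (b : Fin d → ℕ) :
    loopCAtPerm σ σ' ρ A L μ (y + v) b = loopCAtPerm σ σ' ρ (shift ((L : ℤ) • v) A) L μ y b := by
  have h1 : (L : ℤ) • (y + v) + ρ = (L : ℤ) • y + ρ + (L : ℤ) • v := by rw [smul_add]; abel
  have e2 : segUp A ((L : ℤ) • y + ρ + (L : ℤ) • v) μ L = segUp (shift ((L : ℤ) • v) A) ((L : ℤ) • y + ρ) μ L := segUp_add A _ _ μ L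
  unfold loopCAtPerm
  rw [gammaCAtPerm_add, h1, e2]

/-! ## §3 The double mean at linear order -/

/-- [folklore] **THE DOUBLE-MEAN IDENTITY AT LINEAR ORDER**: summing the letters of ALL `(d!)²` pair contours over the block gives `d!` times S1's
symmetrised rooted averaging — `Σ_{x∈B(y)} Σ_{σ,σ′} ΣA(gammaCAtPerm σ σ′ …) = d! · symLinAvgAt ρ A L μ y` (the means over `Γ` and `Γ′` are
independent and the dependence is additive). -/
theorem sum_pairs_gammaCAtPerm (ρ : Site d) (A : Form1 d ℝ) (L : ℕ) (μ : Fin d) (y : Site d) :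
    ∑ b ∈ box d L, ∑ σ : Equiv.Perm (Fin d), ∑ σ' : Equiv.Perm (Fin d), (gammaCAtPerm σ σ' ρ A L μ y b).sum
      = (d ! : ℝ) * symLinAvgAt ρ A L μ y := by
  unfold symLinAvgAt
  rw [Finset.mul_sum]
  refine Finset.sum_congr rfl fun b _ => ?_
  simp only [gammaCAtPerm, List.sum_append, rev_sum, axialPermList_sum, symAxial, Finset.sum_add_distrib, Finset.sum_neg_distrib,
    Finset.sum_const, Finset.card_univ, card_perm_fin, nsmul_eq_mul, ← Finset.mul_sum]
  ring

end

end Summit.QuantumFields.BalabanUV.Beta.SymmetrisedLoopWords
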